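import Summits.ResolutionOfSingularities.ResolutionOfSingularities.Theorems.JetCutVastClasses
import Summits.ResolutionOfSingularities.ResolutionOfSingularities.Theorems.WeakOrderReduction
import Summits.ResolutionOfSingularities.ResolutionOfSingularities.Theorems.FaceFormCutClasses
import Summits.ResolutionOfSingularities.ResolutionOfSingularities.Theorems.VeryNearCutClasses
import Summits.ResolutionOfSingularities.ResolutionOfSingularities.Theorems.VeryNearCutKernels
import Summits.ResolutionOfSingularities.ResolutionOfSingularities.Theorems.DeltaFaceCutClasses
import Summits.ResolutionOfSingularities.ResolutionOfSingularities.Theorems.DeltaFaceCutKernels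
import Summits.ResolutionOfSingularities.ResolutionOfSingularities.Theorems.RelativeDeltaCutClasses
import Summits.ResolutionOfSingularities.ResolutionOfSingularities.Theorems.RelativeDeltaCutKernels
import Summits.ResolutionOfSingularities.ResolutionOfSingularities.Theorems.CurveLeafExitClasses
import Summits.ResolutionOfSingularities.ResolutionOfSingularities.Theorems.CurveLeafExitKernels
import Literature.AlgebraicGeometry.Resolution.HironakaTauScheme
import Literature.AlgebraicGeometry.Resolution.BlowupSequences
import Literature.AlgebraicGeometry.Resolution.MarkedIdeals
import Literature.AlgebraicGeometry.Resolution.StalkSpecializesLocalization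
import Mathlib.Algebra.CharP.Defs
import HarnessLib

/-!
# PurityCutLeaf — decomp-res node «PurityCut» (lens-2 g16 rev 1)

[WRITER NOTE (decomp-res writer g10).  Content VERBATIM from the decomp-res lens-2 g16 node
`HOME/decomp-res-lens-2/g16/PurityCut.lean` rev 1 (pin c1c78f8a = `parts/PurityCut-rev1-c1c78f8a.lean`, 2 025 l;
HOME = run/shared/lean/pub/decomp-res; CRITIC-LEDGER row 140 CLEARED; landing orders INBOX :288 (row-140 line: split
/ order / asides) and :296 (land from rev 1:
docstring-only changes + eight ring-identity kernels).  The lens's §R (l. 121–1020: 89 declarations RESTATED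
VERBATIM-IN-BODY from lens-2 g14 `PinchCut` rev 1 and
g15 `JetCut` rev 5) is DELETED — those are the tree's `PinchCutClasses` / `PinchCutKernels` / `JetCut*` modules
(namespaces `…Theorems.PinchCut`, `…Theorems.JetCut`
with its sub-namespace `Vast`, opened; same short names, byte-identical bodies — never two copies).  Namespace
`…Theorems.PurityCut` (the lens's `Theses.PurityCut`
is gate-reserved), sub-namespaces `Leaf` / `Grand` as in the lens; file split only (tree files ≤ 400 lines):
sections, variables and every declaration exactly as in
the lens.  Node files, in import order: `PurityCutLeaf` (§G) · `PurityCutClasses` (§P, continued `…2` / `…3` as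
needed) · `PurityCutGrand` (§H cone-free: the aside
home) · the wiring `MaxContactCutPurityCut` (§G/§H BY NAME on the host route, in the Theses cone).  All `--supports
stmt-ResolutionOfSingularities-29273`
(`MaxContactCut.RungOne`); nothing closes 29273 — decided halves carry their engines as hypotheses; exactly ONE
located-residual aside is booked on the route for
the lens-2 column (`Grand.GrandSpecialRung`, home `PurityCutGrand`), SUPERSEDING the JetCut residual
`Vast.VastSpecialRung` (critic :288: «if Vast is not yet filed,
file Grand only; never both») and re-locating the tree aside 33866 `LeafSpecialRung` EXACTLY modulo the grand
decided half.  The lens header is kept verbatim below.]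

# PurityCut — the PURE LADDER (D⁺): the `n ∣ k` completion of the principal-tail ladders, typed UNIFORMLY along the top curve
with the LAST-STAGE A-POINT (STRAY) CLAUSE; ENGINE `PureLadderExit` EXACT-ON-PAPER (order exits only, every characteristic and
residue field of the frame); the located residual `Vast.VastSpecialRung` of g15 RE-LOCATED EXACTLY (0 sorry) as
`Grand.GrandSpecialRung`, losing the census-certified purity-jump bed `g = z³ + v(u₁+u₂)³ + (1+v²)u₁⁶ + u₁¹⁰ /𝔽₃`
(decomp-res lens-2 «structural dichotomy (special vs generic)», g16; rev 1: + the TRANSLATION LEMMA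
`pure_translate`, the re-presentation
kernels `represent_S5 / P3 / P5 / P7a / P7b / P8`, `root_S5`, and the census exclusions RE-CLASSIFIED — none is residual, §P1)

ROOT DECOMPOSITION CELL `decomp-res`, RESIDUAL MODE (D-0179), generation 16.  TARGET (tree item, BY NAME):
`MaxContactCut.RungOne` (stmt-ResolutionOfSingularities-29273, `E 2 → E 1`: the dimension-four core of the order axis in
SEQUENCE form), with EXACT edges BY NAME to the tree asides `MaxContactCut.LeafGenericRung` (33865) /
`MaxContactCut.LeafSpecialRung`
(33866) and to the tree theorems `Theorems.CurveLeafExit.rungOne_iff` / `closes` (g13, filed as `Theorems.CurveLeafExitClasses /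
…Kernels / MaxContactCutCurveLeafExit`), `Theorems.RelativeDeltaCut.*` (g12, filed).  ARCHITECTURE: this file IMPORTS the tree
modules of g9–g13 (nothing restated from them) and RESTATES VERBATIM-IN-BODY (§R) exactly the g14 (`PinchCut`,
cleared rows 97/100)
and g15 (`JetCut` rev 5, cleared row 133) declarations it needs — g14/g15 live as HOME files only (their filing is
pending), and a
HOME file cannot be imported by a farm check; every restated body is byte-identical to the pinned source (index in
NODE-g16.md §R),
kernels re-proved verbatim.  New content: §G (the generic LEAF SCHEMA, which makes every re-location below a one-line instance),
§P (the pure ladder), §H (the grand cut).  0 `sorry`, 0 new axioms; `lean check` rc 0.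

## CRITIC WINDOW g16 (CRITIC-LEDGER row 133) — what is priced and how this file answers

«ladders = 0 except (D⁺) (`n ∣ k` completion): DECIDED-MOD-PORT +1 iff (a) typed at `y` UNIFORMLY along `C` as a predicate,
(b) re-locates `Vast.VastSpecialRung` EXACTLY in kernel, (c) a certified inhabitant of bed (i) PROPER (the bridge row
`g = z³ + vU³ + (1+v²)u₁⁶ + u₁¹⁰ /𝔽₃` qualifies once shown to lie in `IsVastSpecialPt`)».
(a) `IsPureLadderAt I n k η y` / `IsUniformPureLadderCurve I n k η` (§P2): ONE predicate at every closed point of `closure {η}`,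
    exponents `(n, k)` uniform, the vanishing order `m` of the leader coefficient, the parameter `π`, `β`, `ε` EXISTENTIAL PER
    POINT (the bed needs `m = 2` at its core and `m = 1` elsewhere) — ring-level shape `PureLadderShape` with the NEW conjunct
    `StrayClean` (the A-point clause, guarded by `BinomGuard`), found NECESSARY AND SUFFICIENT for the last-stage order exit
    (§P (1b)) and confirmed by census-1's engine on 20 rows (11 members / 9 excluded, every excluded conjunct witnessed).
(b) `Grand.vastSpecialRung_iff_grandSpecialRung (hG : GrandGenericRung) : Vast.VastSpecialRung ↔ GrandSpecialRung` and the
    hypothesis-free refinement edge `Grand.grandSpecialRung_of_vastSpecialRung`; also EXACT vs the TREE aside 33866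
    (`Grand.leafSpecialRung_iff_grandSpecialRung`) and vs g14 (`Grand.pinchSpecialRung_iff_grandSpecialRung`);
`Grand.rungOne_iff :
    RungOne ↔ GrandGenericRung ∧ GrandSpecialRung`, `Grand.closes`, `Grand.closes_of_engines` — all PROVED.
(c) §P BED paragraph + NODE-g16.md LEMMA Q: `g` is uniformly pure-ladder-shaped along `C = V(z,u₁,u₂)` (every closed point
    computed: core `m = 2`; `v = ±1`, `v² = −1`, general `v = c`: `m = 1`, clause value of valuation exactly `2 = n − 1`),
    `Top(g) = C`, so its core is a PURE-LADDER-CURVE point (left the residual), and `g ∈ IsVastSpecialPt` by letter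
(pinch-special;
    in none of (L)/(L′)/(D): the persistent `unit·v′²W′⁶` term of one-weight 18 is below every admissible threshold
`3k′+1 ≥ 22`,
    two-weight 12 below the (L′) threshold, (D) needs `3 ∤ k`).  Kernels: `bridge_core_presentation`,
`bridge_unit_presentation`,
    `bridge_unit_clause_value` (PROVED identities over `𝔽₃`).
HYGIENE h1–h4 (row 133): h1 the law asserts EXITS (order `< n` at every point over `C` after `k/n` blow-ups), never a stop kind;
h2 the parity/arithmetic certificates are numbered kernels (`pure_depth`, `stray_no_gap`, the `decide` examples); h3
the docstrings
NAME the census rows (T-deg-plus-selfrun P1–P11, T-pure-stray-selfrun S1–S9, census-1's T-deg-ladder bridge rows); h4 = h7–h9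
carried (statement kinds labelled DEFINITION / STATEMENT / KERNEL (PROVED); sources in every docstring; no instance, notation or
attribute games; the dupNamespace-linter line only).

## PIECES, TAGS, EDGES (all BY NAME; the deciding implication is `Grand.closes`)

* `Grand.GrandGenericRung` — WEAKER · DECIDED-MOD-PORT(M+): `Grand.grandGenericRung_of_engines` from the five tree engines
  (`VeryNearExit`, `DeltaPackageExit`, `UniformCurvePackageExit`, `RelCurvePackageExit`, `NormalConeJumpExit`), g14's
  `MonomialPinchExit` (M) and `FlatConeExit` (C), the grand engine `GrandExit := VastExit ∧ PureLadderExit` ((J)(T)(L)(L′)(D) of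
  g15 and (D⁺) NEW), g12's port `CurvePackagePort n` (COSTUME(M+), engine-free bookkeeping) and `OrderOneContact`.
* `PureLadderExit` — ENGINE (D⁺), NEW, DECIDED on paper (§P law), the +1 candidate of the window.
* `Grand.GrandSpecialRung` — THE LOCATED RESIDUAL: WEAKER BY LETTER than `Vast.VastSpecialRung` (hence than every earlier
  residual of the lineage and than the tree aside 33866), UNDECIDED, IDEA-NEEDED, cofinal (`Grand.grandSpecialRung_iff_rungOne`)
  ⇒ score 0 by rule; its class `IsGrandSpecialPt := IsPinchSpecialPt ∧ ¬ IsGrandCurvePt`.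
* EXACT: `Grand.rungOne_iff`, `Grand.seqDimFour_one_iff`, `Grand.vastSpecialRung_iff_grandSpecialRung (hG)`,
  `Grand.leafSpecialRung_iff_grandSpecialRung (hG)`, `Grand.pinchSpecialRung_iff_grandSpecialRung (hG)`; hypothesis-free letter
  identities `vastSpecialRung_iff : Vast.VastSpecialRung ↔ Leaf.SpecialRung vastLeaf` etc. (§H1).
* MAP edges (unchanged, BY NAME through the tree): `RungOne` ↔ `StepPICoreDimFour` (28544) ↔ `ClosedPointCoreAll` (30461) via
  `MaxContactCutTauLadder.closes` / `MaxContactCutGenericPointCut.rungOne_iff_core_of_rounds` (not re-derived here).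

## WHAT IS LEFT (the grand-special class, honest) and what is NOT claimed

Principal tails whose lowest face has a CANCELLING EDGE FORM (the three binary towers, critic class (ii)); NON-PRINCIPAL `I_y`
(iii); the DEEP-COEFFICIENT germs of the binomial-cone family (MAXIMAL presentation, `n ∣ k`, leader valuation `m ≥ n`; rev 1:
the census exclusions P3 P5 P7a P7b P8 S5 are NOT residual — they re-present into (L)/(D) by the translation lemma
`pure_translate`, kernels `represent_*`, `root_S5`); cone coefficients vanishing to order `≥ 2`; curves failing
uniformity or Top-isolation; the Sing / Tangle / Iso columns (iv) (`HauserE7`, `Narasimhan`: census T-singular-followup says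
blowing up the singular point re-enters the same column — a reduction, not an exit).  NOT claimed: that (D⁺) ∪ (V) exhausts the
purity phenomenon; that the port is hypothesis-free (MAP +1 stays open); any `τ`-statement (the law is order-only, so the
`tauAt`-over-`κ(x)`-vs-`κ̄` question of row 133 is moot here).

## SOURCES
[Hironaka1964] Ann. Math. 79 (Ch. III: permissible centres, weak transforms) · [CossartJannsenSaito2020] LNM 2270,
Ch. 2 (directrix,
near points), Ch. 8–9 (dimension-four order axis) · [CossartPiltant2008] J. Algebra 320, Prop. 4.2 (packages of blow-ups over a
curve) · [CossartPiltant2019] (Rem. 3.2, the residual phenomena) · [BierstoneGrigorievMilmanWlodarczyk2011] §3.1 (marked ideals,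
weak admissibility) · [Moh1987] (purity / jumping phenomenon) · [Hauser2010] (kangaroo points; orientation only) · [Giraud1975],
[Narasimhan1983] (beds of column (iv)) · [HunekeSwanson2006] Cor. 5.5.5 (regularity of the chart rings) · folklore:
quasi-homogeneous blow-up bookkeeping, Hasse-derivative multiplicity criterion, Frobenius additivity.

## This file

§G (NEW, g16): the GENERIC LEAF LEVEL — `namespace Leaf`: the `Leaf` schema (a leaf `L` = a pointwise class of curve
points with its engine as data: `IsGenPt` / `IsSpecPt`, the graded statements `SeqGen` / `SeqSpec`, `GenRungAt`,
**`GenericRung L`** / **`SpecialRung L`**, the EXACT cut `seqDimFour_one_iff`, MONOTONICITY IN THE LEAF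
`genericRung_anti` / `specialRung_mono`, the engine-at-work schema `genRungAt_of_port` / `genericRung_of_port`) —
the dichotomy «decided curve leaf `L` ∨ leaf-special and not in `L`» stated ONCE for every leaf of the lineage;
statement-level + pure-logic kernels, 0 sorry.  Everything naming a `MaxContactCut` route item (`Leaf.rungOne_iff`,
`Leaf.closes`, `Leaf.leafSpecialRung_iff_specialRung`, `Leaf.specialRung_iff_of_le`, …) is in the wiring file
`MaxContactCutPurityCut`.

(Sources: Hironaka1964 Ch. III; CossartJannsenSaito2020 Ch. 2, Ch. 8–9; CossartPiltant2008 Prop. 4.2;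
CossartPiltant2019 Rem. 3.2; BierstoneGrigorievMilmanWlodarczyk2011 §3.1; Moh1987; Hauser2010Kangaroo; Giraud1975;
Narasimhan1983; HunekeSwanson2006 Cor. 5.5.5.)
-/

open CategoryTheory AlgebraicGeometry TopologicalSpace IsLocalRing
open Literature.AlgebraicGeometry.Resolution
open Summit.ResolutionOfSingularities.ResolutionOfSingularities.Theorems
open Summit.ResolutionOfSingularities.ResolutionOfSingularities.Theorems.WeakOrderReduction
open Summit.ResolutionOfSingularities.ResolutionOfSingularities.Theorems.DeltaFaceCutClasses
open Summit.ResolutionOfSingularities.ResolutionOfSingularities.Theorems.RelativeDeltaCut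
open Summit.ResolutionOfSingularities.ResolutionOfSingularities.Theorems.CurveLeafExit
open Summit.ResolutionOfSingularities.ResolutionOfSingularities.Theorems.PinchCut
open Summit.ResolutionOfSingularities.ResolutionOfSingularities.Theorems.JetCut

namespace Summit.ResolutionOfSingularities.ResolutionOfSingularities.Theorems.PurityCut

namespace Leaf

variable (L : ∀ ⦃Y : Scheme.{0}⦄, Y.IdealSheafData → ℕ → Y → Prop)

/-! ## §G  NEW (g16): the GENERIC LEAF LEVEL — the dichotomy «decided curve leaf `L` ∨ leaf-special and not in `L`», its graded
statements, the EXACT cut at each marking and at the rung, `closes` BY NAME, the engines-at-work schema, and MONOTONICITY IN THE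
LEAF — proved ONCE for every predicate `L` (g14's pinch leaf, g15's jet/tame/wide/broad/vast leaves and g16's grand leaf are
instances; the lineage's per-revision «mechanical copies» §K/§TK/§LK/§MK/§NK become one-line instantiations).  Pure
logic, 0 sorry. -/

/-- **The decided union at a point for the curve leaf `L`**: the tree's six decided classes (class ≥ 2, near-generic g10,
δ-generic g11, curve-generic g12, rel-curve-generic / flat-curve g13) or a point of the leaf `L`.  DEFINITION
(schema). [folklore] -/
def IsGenPt {k : Type} [Field k] {Y : Scheme.{0}} (g : Y ⟶ Spec (.of k)) (hY : Scheme.IsRegular Y)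
    (I : Y.IdealSheafData) (n : ℕ) (y : Y) : Prop :=
  (ClassGE g hY I n 2 y ∨ VeryNearCutClasses.IsNearGenericPt I n y ∨ IsDeltaGenericPt I n y ∨
      IsCurveGenericPt I n y ∨ IsRelCurveGenericPt I n y ∨ IsFlatCurvePt I n y) ∨ L I n y

/-- **`L`-SPECIAL point**: leaf-special (tree g13 `IsLeafSpecialPt`) and NOT in the leaf `L` — the located class of
the cut by `L`.
DEFINITION (schema). [folklore] -/
def IsSpecPt {k : Type} [Field k] {Y : Scheme.{0}} (g : Y ⟶ Spec (.of k)) (hY : Scheme.IsRegular Y)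
    (I : Y.IdealSheafData) (n : ℕ) (y : Y) : Prop :=
  IsLeafSpecialPt g hY I n y ∧ ¬ L I n y

/-- **`SeqGen L n`** — weak order reduction in dimension four at marking `n` for data ALL of whose top points lie in the decided
union of the leaf `L` (frame = the binders of `WeakOrderReduction.SeqDimFour`).  STATEMENT SCHEMA. (Sources:
BierstoneGrigorievMilmanWlodarczyk2011 §3.1; CossartPiltant2008 Prop. 4.2; Hironaka1967.) -/
def SeqGen (n : ℕ) : Prop :=
  ∀ p : ℕ, p.Prime → ∀ (k : Type) [Field k] [CharP k p]
    (Y : Scheme.{0}) (g : Y ⟶ Spec (.of k)), IsSeparated g → LocallyOfFiniteType g → QuasiCompact g →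
    ∀ hY : Scheme.IsRegular Y, topologicalKrullDim Y ≤ 4 →
    ∀ I : Y.IdealSheafData, (∀ y : Y, idealOrder I y ≤ ((n : ℕ) : ℕ∞)) →
      (∀ y : Y, idealOrder I y = ((n : ℕ) : ℕ∞) → IsGenPt L g hY I n y) →
      ∃ t : CentreSeq Y, WeakResolution t (⟨I, [], n⟩ : MarkedIdeal Y)

/-- **`SeqSpec L n`** — THE LOCATED CLASS of the cut by `L`: weak order reduction at marking `n` for data having an
`L`-special core
top point.  STATEMENT SCHEMA. (Sources: BierstoneGrigorievMilmanWlodarczyk2011 §3.1; CossartPiltant2019 Rem. 3.2; Moh1987.) -/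
def SeqSpec (n : ℕ) : Prop :=
  ∀ p : ℕ, p.Prime → ∀ (k : Type) [Field k] [CharP k p]
    (Y : Scheme.{0}) (g : Y ⟶ Spec (.of k)), IsSeparated g → LocallyOfFiniteType g → QuasiCompact g →
    ∀ hY : Scheme.IsRegular Y, topologicalKrullDim Y ≤ 4 →
    ∀ I : Y.IdealSheafData, (∀ y : Y, idealOrder I y ≤ ((n : ℕ) : ℕ∞)) →
      (∃ y : Y, idealOrder I y = ((n : ℕ) : ℕ∞) ∧ IsSpecPt L g hY I n y) →
      ∃ t : CentreSeq Y, WeakResolution t (⟨I, [], n⟩ : MarkedIdeal Y)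

/-- `GenRungAt L n` — the decided rung at one marking. -/
def GenRungAt (n : ℕ) : Prop := SeqDimFour 2 n → SeqGen L n

/-- **`GenericRung L`** — the DECIDED half of `RungOne` for the leaf `L`. STATEMENT SCHEMA (decided piece). -/
def GenericRung : Prop := E 2 → ∀ n : ℕ, 1 ≤ n → SeqGen L n

/-- **`SpecialRung L`** — the LOCATED RESIDUAL of the cut by `L`. STATEMENT SCHEMA (located residual). -/
def SpecialRung : Prop := E 2 → ∀ n : ℕ, 1 ≤ n → SeqSpec L n

section Kernels

variable {L}
variable {n : ℕ}

/-- Pointwise EXHAUSTION for any leaf. [folklore] -/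
theorem isGenPt_or_isSpecPt {k : Type} [Field k] {Y : Scheme.{0}} (g : Y ⟶ Spec (.of k))
    (hY : Scheme.IsRegular Y) (I : Y.IdealSheafData) (n : ℕ) (y : Y) :
    IsGenPt L g hY I n y ∨ IsSpecPt L g hY I n y := by
  rcases classGE_or_gen_or_lspecial g hY I n y with h | h
  · exact Or.inl (Or.inl h)
  · by_cases hL : L I n y
    · exact Or.inl (Or.inr hL)
    · exact Or.inr ⟨h, hL⟩

/-- An `L`-special point is not in the decided union. [folklore] -/
theorem not_isGenPt_of_isSpecPt {k : Type} [Field k] {Y : Scheme.{0}} {g : Y ⟶ Spec (.of k)}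
    {hY : Scheme.IsRegular Y} {I : Y.IdealSheafData} {n : ℕ} {y : Y} (h : IsSpecPt L g hY I n y) :
    ¬ IsGenPt L g hY I n y := by
  rintro (h6 | hL)
  · exact not_gen_of_isLeafSpecialPt h.1 h6
  · exact h.2 hL

/-- **EXACT at each marking**: `SeqDimFour 1 n ⟺ SeqGen L n ∧ SeqSpec L n`. [folklore] -/
theorem seqDimFour_one_iff : SeqDimFour 1 n ↔ SeqGen L n ∧ SeqSpec L n := by
  constructor
  · intro h
    refine ⟨?_, ?_⟩
    · intro p hp k _ _ Y g h1 h2 h3 hY h4 I hord _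
      exact h p hp k Y g h1 h2 h3 hY h4 I hord (fun y _ => Or.inl le_rfl)
    · intro p hp k _ _ Y g h1 h2 h3 hY h4 I hord _
      exact h p hp k Y g h1 h2 h3 hY h4 I hord (fun y _ => Or.inl le_rfl)
  · rintro ⟨hG, hS⟩ p hp k _ _ Y g h1 h2 h3 hY h4 I hord _
    by_cases hex : ∃ y : Y, idealOrder I y = ((n : ℕ) : ℕ∞) ∧ IsSpecPt L g hY I n y
    · exact hS p hp k Y g h1 h2 h3 hY h4 I hord hex
    · refine hG p hp k Y g h1 h2 h3 hY h4 I hord ?_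
      intro y hy
      rcases isGenPt_or_isSpecPt (L := L) g hY I n y with h | h
      · exact h
      · exact absurd ⟨y, hy, h⟩ hex

/-- `SeqGen L n` is `SeqDimFour 1 n` restricted: weaker BY LETTER. [folklore] -/
theorem seqGen_of_seqDimFour_one (h : SeqDimFour 1 n) : SeqGen L n := ((seqDimFour_one_iff (L := L)).mp h).1

/-- `SeqSpec L n` is `SeqDimFour 1 n` restricted: weaker BY LETTER. [folklore] -/
theorem seqSpec_of_seqDimFour_one (h : SeqDimFour 1 n) : SeqSpec L n := ((seqDimFour_one_iff (L := L)).mp h).2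

/-- `SeqDimFour 2 n` is `SeqGen L n` restricted. [folklore] -/
theorem seqDimFour_two_of_seqGen (h : SeqGen L n) : SeqDimFour 2 n := by
  intro p hp k _ _ Y g h1 h2 h3 hY h4 I hord hcls
  exact h p hp k Y g h1 h2 h3 hY h4 I hord (fun y hy => Or.inl (Or.inl (hcls y hy)))

/-- The tree's g13 decided statement is `SeqGen L n` restricted (any leaf contains the empty leaf). [folklore] -/
theorem seqLGen_of_seqGen (h : SeqGen L n) : SeqLGen n := by
  intro p hp k _ _ Y g h1 h2 h3 hY h4 I hord hcls
  exact h p hp k Y g h1 h2 h3 hY h4 I hord (fun y hy => Or.inl (hcls y hy))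

/-- The tree's g13 located class contains `SeqSpec L n` pointwise, so `SeqLSpec n → SeqSpec L n`. [folklore] -/
theorem seqSpec_of_seqLSpec (h : SeqLSpec n) : SeqSpec L n := by
  intro p hp k _ _ Y g h1 h2 h3 hY h4 I hord hex
  obtain ⟨y, hy, hs⟩ := hex
  exact h p hp k Y g h1 h2 h3 hY h4 I hord ⟨y, hy, hs.1⟩

/-- **THE ENGINES AT WORK (schema)**: the five tree engines, an «`L`-points are curve-exit points» hypothesis for
the leaf, and g12's
port give `GenRungAt L n` for `n ≥ 2`. [folklore] -/
theorem genRungAt_of_port (hV : VeryNearCutClasses.VeryNearExit) (hD : DeltaPackageExit)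
    (hU : UniformCurvePackageExit) (hR : RelCurvePackageExit) (hN : NormalConeJumpExit)
    (hL : ∀ ⦃Y : Scheme.{0}⦄, Scheme.IsRegular Y → ∀ ⦃I : Y.IdealSheafData⦄ ⦃y : Y⦄, L I n y → IsCurveExitPt I n y)
    (hP : CurvePackagePort n) (hn : 2 ≤ n) : GenRungAt L n := by
  intro h2 p hp k _ _ Y g hg1 hg2 hg3 hY h4 I hord hcls
  refine hP h2 p hp k Y g hg1 hg2 hg3 hY h4 I hord ?_
  intro y hy
  rcases hcls y hy with (h | h | h | h | h | h) | h
  · exact Or.inl h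
  · exact Or.inr (Or.inl (isNearExitPt_of_isNearGenericPt hV hY hn h))
  · exact Or.inr (Or.inr (Or.inl (isPackageExitPt_of_isDeltaGenericPt hD hY hn hy h)))
  · exact Or.inr (Or.inr (Or.inr (isCurveExitPt_of_isCurveGenericPt hU hY hn h)))
  · exact Or.inr (Or.inr (Or.inr (isCurveExitPt_of_isRelCurveGenericPt hR hY hn h)))
  · exact Or.inr (Or.inr (Or.inr (isCurveExitPt_of_isFlatCurvePt hN hY hn h)))
  · exact Or.inr (Or.inr (Or.inr (hL hY h)))

/-- At marking `1` every top point is a contact point (tree port `OrderOneContact`). [folklore] -/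
theorem genRungAt_one (h1 : FaceFormCutClasses.OrderOneContact) : GenRungAt L 1 := by
  intro h2 p hp k _ _ Y g hg1 hg2 hg3 hY h4 I hord _
  refine h2 p hp k Y g hg1 hg2 hg3 hY h4 I hord ?_
  intro y hy
  exact Or.inr (Or.inl (h1 p hp k Y g hg1 hg2 hg3 hY I y hy))

/-- **`GenericRung L` is DECIDED modulo the typed pieces** (schema). [folklore] -/
theorem genericRung_of_port (hV : VeryNearCutClasses.VeryNearExit) (hD : DeltaPackageExit)
    (hU : UniformCurvePackageExit) (hR : RelCurvePackageExit) (hN : NormalConeJumpExit)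
    (hL : ∀ n : ℕ, 2 ≤ n → ∀ ⦃Y : Scheme.{0}⦄, Scheme.IsRegular Y → ∀ ⦃I : Y.IdealSheafData⦄ ⦃y : Y⦄,
      L I n y → IsCurveExitPt I n y)
    (hP : ∀ n : ℕ, 2 ≤ n → CurvePackagePort n) (h1 : FaceFormCutClasses.OrderOneContact) : GenericRung L := by
  intro hE2 n hn
  by_cases h : 2 ≤ n
  · exact genRungAt_of_port hV hD hU hR hN (hL n h) (hP n h) h (hE2 n hn)
  · have hn1 : n = 1 := by omega
    subst hn1
    exact genRungAt_one h1 (hE2 1 hn)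

variable {L' : ∀ ⦃Y : Scheme.{0}⦄, Y.IdealSheafData → ℕ → Y → Prop}

/-! ### MONOTONICITY IN THE LEAF: a bigger leaf has a SMALLER located residual and a STRONGER decided half; modulo
the bigger leaf's
decided half the two residuals are EQUIVALENT (every re-location of the lineage is this lemma). -/

/-- The decided statement is ANTITONE in the leaf. [folklore] -/
theorem seqGen_anti (hLL' : ∀ ⦃Y : Scheme.{0}⦄ (I : Y.IdealSheafData) (n : ℕ) (y : Y), L I n y → L' I n y)
    (h : SeqGen L' n) : SeqGen L n := by
  intro p hp k _ _ Y g h1 h2 h3 hY h4 I hord hcls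
  refine h p hp k Y g h1 h2 h3 hY h4 I hord ?_
  intro y hy
  rcases hcls y hy with h6 | hL
  · exact Or.inl h6
  · exact Or.inr (hLL' I n y hL)

/-- The located class is MONOTONE in the leaf (the residual SHRINKS). [folklore] -/
theorem seqSpec_mono (hLL' : ∀ ⦃Y : Scheme.{0}⦄ (I : Y.IdealSheafData) (n : ℕ) (y : Y), L I n y → L' I n y)
    (h : SeqSpec L n) : SeqSpec L' n := by
  intro p hp k _ _ Y g h1 h2 h3 hY h4 I hord hex
  obtain ⟨y, hy, hs⟩ := hex
  exact h p hp k Y g h1 h2 h3 hY h4 I hord ⟨y, hy, hs.1, fun hL => hs.2 (hLL' I n y hL)⟩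

/-- `GenericRung` is antitone in the leaf. [folklore] -/
theorem genericRung_anti (hLL' : ∀ ⦃Y : Scheme.{0}⦄ (I : Y.IdealSheafData) (n : ℕ) (y : Y), L I n y → L' I n y)
    (h : GenericRung L') : GenericRung L :=
  fun hE2 n hn => seqGen_anti hLL' (h hE2 n hn)

/-- `SpecialRung` is monotone in the leaf: WEAKER BY LETTER for the bigger leaf. [folklore] -/
theorem specialRung_mono (hLL' : ∀ ⦃Y : Scheme.{0}⦄ (I : Y.IdealSheafData) (n : ℕ) (y : Y), L I n y → L' I n y)
    (h : SpecialRung L) : SpecialRung L' :=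
  fun hE2 n hn => seqSpec_mono hLL' (h hE2 n hn)

end Kernels

end Leaf

end Summit.ResolutionOfSingularities.ResolutionOfSingularities.Theorems.PurityCut
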